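import Literature.Topology.Immersions.ProjBundleOrientation
import Literature.Topology.Immersions.ProjBundleBasic
import Literature.Topology.Immersions.DoublePointsGenericity
import Literature.Topology.FourManifolds.ChartDerivative
import Literature.Topology.FourManifolds.SmoothOrientation
import Mathlib.LinearAlgebra.Matrix.Block
import Mathlib.Topology.Instances.Matrix
import HarnessLib

/-!
# The orientation of the normal bundle of an immersion of an oriented manifold

Topic `Literature/Topology/Immersions`. For a `C^∞` immersion `f : M → ℝ^q` of an **oriented**
`n`-manifold (`SmoothOrientation (𝓡 n) M`, `SmoothOrientation.lean`) the normal bundle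
`ν_f = ProjBundle.normal …` (`NormalProjBundle.lean`) carries the orientation characterised by

  (positive basis of `T_x M` under `df_x`, positive basis of `ν_x`) is a positive basis of `ℝ^q`

(Milnor–Stasheff, *Characteristic Classes* (1974), §9 p. 96 ff., §11: "the normal bundle is
oriented so that `τ ⊕ ν` has the standard orientation"; Kirby, *The Topology of 4-Manifolds*
(1989), Ch. II p. 22 / Ch. VI p. 40: signs of intersection and triple points "according to whether
the orientations … combine to give the orientation of `R⁶`"). This file proves that this rule
defines an orientation of `ν_f` in the sense of `ProjBundleOrientation.lean`
(`ProjBundle.isOrientation_normalOrientation`).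

Linear algebra (`juxtMat`, `juxtDet`): the determinant of the juxtaposed family
`(T e₁, …, T e_n, C e₁, …, C e_k)` in `ℝ^q` (`k + n = q`), its multiplicativity under
`T ↦ T ∘ h`, `C ↦ C ∘ g` (`juxtDet_comp`, block matrices), nonvanishing for a tangent frame and
a normal frame (`juxtDet_ne_zero_of_frames`), continuity. Geometry: `df_x` read in the chart at
`p` is `D(f ∘ φₚ⁻¹)(φₚ x) ∘ tangentCoordChange x p x` (the tree's `mfderiv_eq_chartDeriv_comp`,
Mathlib's `mfderiv_chartAt_eq_tangentCoordChange`), and the smooth orientation of `M` satisfies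
`o x = o p ↔ 0 < det (tangentCoordChange x p x)` near `p`; so the sign rule is locally constant
against the bundle-chart frames, which is `ProjBundle.isOrientation_of_localFrame`'s
hypothesis in the form of `ProjBundle.IsOrientation`.

Everything here is proved; the definitions are data; no named facts are introduced.

## References

* J. Milnor, J. Stasheff, *Characteristic Classes* (1974), §9, §11. [MilnorStasheff1974]
* R. C. Kirby, *The Topology of 4-Manifolds*, LNM 1374 (1989), Ch. II, Ch. VI. [Kirby1989]
-/

open scoped Manifold ContDiff Topology Matrix
open Set Function Module Filter

noncomputable section

namespace Literature.Topology.Immersions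

/-- Local notation: `𝔼 n` is the model Euclidean space `EuclideanSpace ℝ (Fin n)`. -/
local notation "𝔼 " n:arg => EuclideanSpace ℝ (Fin n)

open Literature.Topology.FourManifolds (SmoothOrientation euclideanOrientation tangentPlane
  normalSpace leftInv apply_leftInv_of_mem_range chartDeriv mfderiv_eq_chartDeriv_comp
  contDiffOn_chartDeriv injective_chartDeriv mfderiv_mem_tangentPlane)

/-! ### The juxtaposition determinant -/

section LinearAlgebra

variable {n k q : ℕ}

/-- The index identification `Fin n ⊕ Fin k ≃ Fin q` (`k + n = q`): tangent indices first.
[folklore] -/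
def sumIdx (hk : k + n = q) : Fin n ⊕ Fin k ≃ Fin q :=
  finSumFinEquiv.trans (finCongr (by omega))

/-- The juxtaposed family `(T e₁, …, T e_n, C e₁, …, C e_k)` of vectors of `ℝ^q`. [folklore] -/
def juxt (T : 𝔼 n →L[ℝ] 𝔼 q) (C : 𝔼 k →L[ℝ] 𝔼 q) : Fin n ⊕ Fin k → 𝔼 q :=
  Sum.elim (fun i => T (EuclideanSpace.single i 1)) fun j => C (EuclideanSpace.single j 1)

/-- The square matrix of the juxtaposed family (rows = coordinates of `ℝ^q` via `sumIdx`,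
columns = family index). [folklore] -/
def juxtMat (hk : k + n = q) (T : 𝔼 n →L[ℝ] 𝔼 q) (C : 𝔼 k →L[ℝ] 𝔼 q) :
    Matrix (Fin n ⊕ Fin k) (Fin n ⊕ Fin k) ℝ :=
  Matrix.of fun r c => juxt T C c (sumIdx hk r)

/-- **The juxtaposition determinant** `det (T e₁, …, T e_n, C e₁, …, C e_k)`. [folklore] -/
def juxtDet (hk : k + n = q) (T : 𝔼 n →L[ℝ] 𝔼 q) (C : 𝔼 k →L[ℝ] 𝔼 q) : ℝ :=
  (juxtMat hk T C).det

/-- The coordinate matrix of an endomorphism of `ℝᵈ` in the standard basis. [folklore] -/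
def stdMat {d : ℕ} (h : 𝔼 d →L[ℝ] 𝔼 d) : Matrix (Fin d) (Fin d) ℝ :=
  Matrix.of fun i j => h (EuclideanSpace.single j 1) i

/-- `det (stdMat h) = det h`. [folklore] -/
theorem det_stdMat {d : ℕ} (h : 𝔼 d →L[ℝ] 𝔼 d) :
    (stdMat h).det = LinearMap.det (h : 𝔼 d →ₗ[ℝ] 𝔼 d) := by
  classical
  rw [← LinearMap.det_toMatrix (EuclideanSpace.basisFun (Fin d) ℝ).toBasis]
  congr 1

/-- A vector of `ℝᵈ` is the combination of the standard basis vectors with its coordinates.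
[folklore] -/
theorem eq_sum_single {d : ℕ} (v : 𝔼 d) : v = ∑ i, v i • EuclideanSpace.single i (1 : ℝ) := by
  simpa using ((EuclideanSpace.basisFun (Fin d) ℝ).sum_repr v).symm

/-- **Multiplicativity**: `juxtMat (T ∘ h) (C ∘ g) = juxtMat T C · diag(H, G)`. [folklore] -/
theorem juxtMat_comp (hk : k + n = q) (T : 𝔼 n →L[ℝ] 𝔼 q) (C : 𝔼 k →L[ℝ] 𝔼 q)
    (h : 𝔼 n →L[ℝ] 𝔼 n) (g : 𝔼 k →L[ℝ] 𝔼 k) :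
    juxtMat hk (T.comp h) (C.comp g) =
      juxtMat hk T C * Matrix.fromBlocks (stdMat h) 0 0 (stdMat g) := by
  ext r c
  rw [Matrix.mul_apply, Fintype.sum_sum_type]
  rcases c with c | c
  · simp only [juxtMat, juxt, Matrix.of_apply, Sum.elim_inl, Sum.elim_inr,
      ContinuousLinearMap.comp_apply, Matrix.fromBlocks_apply₁₁, Matrix.fromBlocks_apply₂₁,
      Matrix.zero_apply, mul_zero, Finset.sum_const_zero, add_zero, stdMat]
    conv_lhs => rw [eq_sum_single (h (EuclideanSpace.single c 1)), map_sum]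
    simp [map_smul, Finset.sum_apply, mul_comm]
  · simp only [juxtMat, juxt, Matrix.of_apply, Sum.elim_inl, Sum.elim_inr,
      ContinuousLinearMap.comp_apply, Matrix.fromBlocks_apply₁₂, Matrix.fromBlocks_apply₂₂,
      Matrix.zero_apply, mul_zero, Finset.sum_const_zero, zero_add, stdMat]
    conv_lhs => rw [eq_sum_single (g (EuclideanSpace.single c 1)), map_sum]
    simp [map_smul, Finset.sum_apply, mul_comm]

/-- **`juxtDet (T ∘ h) (C ∘ g) = det h · det g · juxtDet T C`.** [folklore] -/
theorem juxtDet_comp (hk : k + n = q) (T : 𝔼 n →L[ℝ] 𝔼 q) (C : 𝔼 k →L[ℝ] 𝔼 q)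
    (h : 𝔼 n →L[ℝ] 𝔼 n) (g : 𝔼 k →L[ℝ] 𝔼 k) :
    juxtDet hk (T.comp h) (C.comp g) =
      LinearMap.det (h : 𝔼 n →ₗ[ℝ] 𝔼 n) * LinearMap.det (g : 𝔼 k →ₗ[ℝ] 𝔼 k) * juxtDet hk T C := by
  rw [juxtDet, juxtMat_comp, Matrix.det_mul, Matrix.det_fromBlocks_zero₂₁, det_stdMat, det_stdMat,
    juxtDet]
  ring

/-- The standard basis of `ℝ^q` indexed by `Fin n ⊕ Fin k`. [folklore] -/
def stdBasisSum (hk : k + n = q) : Basis (Fin n ⊕ Fin k) ℝ (𝔼 q) :=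
  (EuclideanSpace.basisFun (Fin q) ℝ).toBasis.reindex (sumIdx hk).symm

/-- `juxtDet` is the basis determinant of the juxtaposed family. [folklore] -/
theorem juxtDet_eq_basis_det (hk : k + n = q) (T : 𝔼 n →L[ℝ] 𝔼 q) (C : 𝔼 k →L[ℝ] 𝔼 q) :
    juxtDet hk T C = (stdBasisSum hk).det (juxt T C) := by
  classical
  rw [Basis.det_apply, juxtDet]
  congr 1

/-- **`juxtDet ≠ 0` iff the juxtaposed family is linearly independent.** [folklore] -/
theorem juxtDet_ne_zero_iff (hk : k + n = q) (T : 𝔼 n →L[ℝ] 𝔼 q) (C : 𝔼 k →L[ℝ] 𝔼 q) :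
    juxtDet hk T C ≠ 0 ↔ LinearIndependent ℝ (juxt T C) := by
  rw [juxtDet_eq_basis_det]
  constructor
  · intro h
    exact ((stdBasisSum hk).is_basis_iff_det.2 (isUnit_iff_ne_zero.2 h)).1
  · intro hli
    have hcard : Fintype.card (Fin n ⊕ Fin k) = finrank ℝ (𝔼 q) := by
      rw [Fintype.card_sum, Fintype.card_fin, Fintype.card_fin, finrank_euclideanSpace_fin]
      omega
    have hsp := hli.span_eq_top_of_card_eq_finrank' hcard
    exact isUnit_iff_ne_zero.1 ((stdBasisSum hk).is_basis_iff_det.1 ⟨hli, hsp⟩)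

/-- **Continuity of the juxtaposition determinant** in `(T, C)`. [folklore] -/
theorem continuous_juxtDet (hk : k + n = q) :
    Continuous fun TC : (𝔼 n →L[ℝ] 𝔼 q) × (𝔼 k →L[ℝ] 𝔼 q) => juxtDet hk TC.1 TC.2 := by
  unfold juxtDet
  refine Continuous.matrix_det ?_
  refine continuous_pi fun r => continuous_pi fun c => ?_
  rcases c with c | c
  · simp only [juxtMat, juxt, Matrix.of_apply, Sum.elim_inl]
    exact (EuclideanSpace.proj (sumIdx hk r)).continuous.comp
      ((ContinuousLinearMap.apply ℝ (𝔼 q) (EuclideanSpace.single c (1 : ℝ))).continuous.comp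
        continuous_fst)
  · simp only [juxtMat, juxt, Matrix.of_apply, Sum.elim_inr]
    exact (EuclideanSpace.proj (sumIdx hk r)).continuous.comp
      ((ContinuousLinearMap.apply ℝ (𝔼 q) (EuclideanSpace.single c (1 : ℝ))).continuous.comp
        continuous_snd)

end LinearAlgebra

/-! ### Sign bookkeeping -/

/-- If `u * v > 0` then `u > 0 ↔ v > 0`. [folklore] -/
theorem pos_iff_pos_of_mul_pos {u v : ℝ} (h : 0 < u * v) : (0 < u ↔ 0 < v) := by
  rcases mul_pos_iff.1 h with ⟨hu, hv⟩ | ⟨hu, hv⟩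
  · exact ⟨fun _ => hv, fun _ => hu⟩
  · exact ⟨fun h' => absurd hu (not_lt.2 h'.le), fun h' => absurd hv (not_lt.2 h'.le)⟩

/-- The **sign of an orientation of `ℝⁿ`** against the standard one, as a real number `±1`
(the real-valued counterpart of `orSign` of `TriplePointSign.lean`). [folklore] -/
def tsign {n : ℕ} (o : Orientation ℝ (𝔼 n) (Fin (finrank ℝ (𝔼 n)))) : ℝ := by
  classical
  exact if o = euclideanOrientation n then 1 else -1

/-- `tsign o ≠ 0`. [folklore] -/
theorem tsign_ne_zero {n : ℕ} (o : Orientation ℝ (𝔼 n) (Fin (finrank ℝ (𝔼 n)))) : tsign o ≠ 0 := by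
  classical
  unfold tsign
  split_ifs <;> norm_num

/-- `tsign o * tsign o' > 0 ↔ o = o'`. [folklore] -/
theorem tsign_mul_tsign_pos_iff {n : ℕ} (o o' : Orientation ℝ (𝔼 n) (Fin (finrank ℝ (𝔼 n)))) :
    0 < tsign o * tsign o' ↔ o = o' := by
  have hcard : Fintype.card (Fin (finrank ℝ (𝔼 n))) = finrank ℝ (𝔼 n) := Fintype.card_fin _
  classical
  unfold tsign
  by_cases h : o = euclideanOrientation n <;> by_cases h' : o' = euclideanOrientation n
  · rw [if_pos h, if_pos h', h, h']
    norm_num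
  · rw [if_pos h, if_neg h']
    norm_num
    intro he
    exact h' (he ▸ h)
  · rw [if_neg h, if_pos h']
    norm_num
    intro he
    exact h (he.trans h')
  · rw [if_neg h, if_neg h']
    norm_num
    rcases o.eq_or_eq_neg (euclideanOrientation n) hcard with h1 | h1
    · exact absurd h1 h
    rcases o'.eq_or_eq_neg (euclideanOrientation n) hcard with h2 | h2
    · exact absurd h2 h'
    rw [h1, h2]

/-! ### The normal bundle of an immersion of an oriented manifold -/

section Normal

variable {n k q : ℕ} {M : Type*} [TopologicalSpace M] [ChartedSpace (𝔼 n) M]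
  [IsManifold (𝓡 n) ∞ M]

/-- **A tangent frame and a normal frame juxtapose to a basis of `ℝ^q`**: for an immersion `f`
and a frame `C` of the normal fibre at `x`, `juxtDet (df_x) C ≠ 0`. [folklore] -/
theorem juxtDet_ediff_ne_zero (hk : k + n = q) {f : M → 𝔼 q} (hf : ContMDiff (𝓡 n) (𝓡 q) ∞ f)
    (himm : ∀ x, Injective (mfderiv (𝓡 n) (𝓡 q) f x)) (x : M) (C : 𝔼 k →L[ℝ] 𝔼 q)
    (hC : Injective C)
    (hr : LinearMap.range C.toLinearMap = (ProjBundle.normal hk f hf himm).fibre x) :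
    juxtDet hk (ediff n q f x) C ≠ 0 := by
  rw [juxtDet_ne_zero_iff, juxt, linearIndependent_sum]
  have hb := fun d => (EuclideanSpace.basisFun (Fin d) ℝ).toBasis.linearIndependent
  refine ⟨?_, ?_, ?_⟩
  · have h1 := (hb n).map' (ediff n q f x : 𝔼 n →ₗ[ℝ] 𝔼 q)
      (LinearMap.ker_eq_bot.2 ((injective_ediff_iff f x).2 (himm x)))
    simpa [Function.comp_def] using h1
  · have h1 := (hb k).map' (C : 𝔼 k →ₗ[ℝ] 𝔼 q) (LinearMap.ker_eq_bot.2 hC)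
    simpa [Function.comp_def] using h1
  · have h1 : Submodule.span ℝ (range ((Sum.elim (fun i => ediff n q f x (EuclideanSpace.single i 1))
        fun j => C (EuclideanSpace.single j 1)) ∘ Sum.inl)) ≤ tangentPlane (𝓡 n) f x := by
      rw [Submodule.span_le]
      rintro _ ⟨i, rfl⟩
      exact mfderiv_mem_tangentPlane (I := 𝓡 n) f x _
    have h2 : Submodule.span ℝ (range ((Sum.elim (fun i => ediff n q f x (EuclideanSpace.single i 1))
        fun j => C (EuclideanSpace.single j 1)) ∘ Sum.inr)) ≤ (tangentPlane (𝓡 n) f x)ᗮ := by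
      rw [Submodule.span_le]
      rintro _ ⟨j, rfl⟩
      have : C (EuclideanSpace.single j 1) ∈ (ProjBundle.normal hk f hf himm).fibre x :=
        hr ▸ LinearMap.mem_range_self _ _
      rw [ProjBundle.fibre_normal_eq] at this
      exact this
    exact (Submodule.isOrtho_orthogonal_right _).disjoint.mono h1 h2

variable (hk : k + n = q) {f : M → 𝔼 q} (hf : ContMDiff (𝓡 n) (𝓡 q) ∞ f)
  (himm : ∀ x, Injective (mfderiv (𝓡 n) (𝓡 q) f x)) (oM : SmoothOrientation (𝓡 n) M)

/-- The normal orientation at `x` computed with a given normal frame `C`: the orientation of `C`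
if `(positive tangent basis, C)` is positive in `ℝ^q`, its opposite otherwise. [folklore] -/
def normalOrientationAux (x : M) (C : 𝔼 k →L[ℝ] 𝔼 q) (hC : Injective C)
    (hr : LinearMap.range C.toLinearMap = (ProjBundle.normal hk f hf himm).fibre x) :
    Orientation ℝ ((ProjBundle.normal hk f hf himm).fibre x) (Fin k) :=
  if 0 < tsign (oM x) * juxtDet hk (ediff n q f x) C then
    (ProjBundle.normal hk f hf himm).orientationOfFrame C hC hr
  else -(ProjBundle.normal hk f hf himm).orientationOfFrame C hC hr

/-- **The orientation of the normal bundle of an immersion of an oriented manifold**: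
`(df_x(positive basis of T_x M), positive basis of ν_x)` is a positive basis of `ℝ^q`.
[cite: MilnorStasheff1974, §9 p. 96, §11] -/
def normalOrientation (x : M) : Orientation ℝ ((ProjBundle.normal hk f hf himm).fibre x) (Fin k) :=
  normalOrientationAux hk hf himm oM x ((ProjBundle.normal hk f hf himm).frameAt x x)
    ((ProjBundle.normal hk f hf himm).mem_goodSet_self x).2
    ((ProjBundle.normal hk f hf himm).range_frameAt_of_mem
      ((ProjBundle.normal hk f hf himm).mem_goodSet_self x))

/-- The auxiliary orientation equals the frame orientation iff the sign condition holds.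
[folklore] -/
theorem normalOrientationAux_eq_iff (x : M) (C : 𝔼 k →L[ℝ] 𝔼 q) (hC : Injective C)
    (hr : LinearMap.range C.toLinearMap = (ProjBundle.normal hk f hf himm).fibre x) :
    normalOrientationAux hk hf himm oM x C hC hr =
        (ProjBundle.normal hk f hf himm).orientationOfFrame C hC hr ↔
      0 < tsign (oM x) * juxtDet hk (ediff n q f x) C := by
  unfold normalOrientationAux
  split_ifs with h
  · exact ⟨fun _ => h, fun _ => rfl⟩
  · refine ⟨fun h' => ?_, fun h' => absurd h' h⟩
    exact absurd h'.symm (Module.Ray.ne_neg_self _)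

/-- **Frame independence** of the normal orientation. [folklore] -/
theorem normalOrientationAux_eq (x : M) (C C' : 𝔼 k →L[ℝ] 𝔼 q) (hC : Injective C)
    (hC' : Injective C')
    (hr : LinearMap.range C.toLinearMap = (ProjBundle.normal hk f hf himm).fibre x)
    (hr' : LinearMap.range C'.toLinearMap = (ProjBundle.normal hk f hf himm).fibre x) :
    normalOrientationAux hk hf himm oM x C hC hr = normalOrientationAux hk hf himm oM x C' hC' hr' := by
  -- `C' = C ∘ g`, `g` the frame transition
  have hCg : C' = C.comp (ProjBundle.frameTransition C C') := by
    ext1 u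
    show C' u = C (leftInv C (C' u))
    rw [apply_leftInv_of_mem_range hC]
    rw [hr, ← hr']
    exact LinearMap.mem_range_self _ u
  have hjd : juxtDet hk (ediff n q f x) C' =
      LinearMap.det (ProjBundle.frameTransition C C' : 𝔼 k →ₗ[ℝ] 𝔼 k) *
        juxtDet hk (ediff n q f x) C := by
    conv_lhs => rw [hCg, ← (ediff n q f x).comp_id]
    rw [juxtDet_comp]
    simp
  have hJ : juxtDet hk (ediff n q f x) C ≠ 0 := juxtDet_ediff_ne_zero hk hf himm x C hC hr
  have ht : tsign (oM x) ≠ 0 := tsign_ne_zero _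
  have hdet : LinearMap.det (ProjBundle.frameTransition C C' : 𝔼 k →ₗ[ℝ] 𝔼 k) ≠ 0 :=
    (ProjBundle.normal hk f hf himm).det_frameTransition_ne_zero C C' hC hC' hr hr'
  rcases lt_or_gt_of_ne hdet with hneg | hpos
  · -- orientation flips, sign flips
    have hO : (ProjBundle.normal hk f hf himm).orientationOfFrame C' hC' hr' = -(ProjBundle.normal hk f hf himm).orientationOfFrame C hC hr := by
      rw [eq_comm, (ProjBundle.normal hk f hf himm).neg_eq_iff_ne]
      intro h
      exact absurd (((ProjBundle.normal hk f hf himm).orientationOfFrame_eq_iff_det_pos C C' hC hC' hr hr').1 h)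
        (not_lt.2 hneg.le)
    have hiff : (0 < tsign (oM x) * juxtDet hk (ediff n q f x) C') ↔
        ¬ (0 < tsign (oM x) * juxtDet hk (ediff n q f x) C) := by
      rw [hjd, mul_left_comm]
      have ha : tsign (oM x) * juxtDet hk (ediff n q f x) C ≠ 0 := mul_ne_zero ht hJ
      constructor
      · intro h hpos'
        have : LinearMap.det (ProjBundle.frameTransition C C' : 𝔼 k →ₗ[ℝ] 𝔼 k) *
            (tsign (oM x) * juxtDet hk (ediff n q f x) C) < 0 := mul_neg_of_neg_of_pos hneg hpos'
        linarith
      · intro h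
        exact mul_pos_of_neg_of_neg hneg (lt_of_le_of_ne (not_lt.1 h) ha)
    unfold normalOrientationAux
    by_cases hc : 0 < tsign (oM x) * juxtDet hk (ediff n q f x) C
    · rw [if_pos hc, if_neg (fun h' => hiff.1 h' hc), hO]
      exact (neg_neg ((ProjBundle.normal hk f hf himm).orientationOfFrame C hC hr)).symm
    · rw [if_neg hc, if_pos (hiff.2 hc), hO]
  · -- same orientation, same sign
    have hO : (ProjBundle.normal hk f hf himm).orientationOfFrame C hC hr = (ProjBundle.normal hk f hf himm).orientationOfFrame C' hC' hr' :=
      ((ProjBundle.normal hk f hf himm).orientationOfFrame_eq_iff_det_pos C C' hC hC' hr hr').2 hpos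
    have hiff : (0 < tsign (oM x) * juxtDet hk (ediff n q f x) C') ↔
        (0 < tsign (oM x) * juxtDet hk (ediff n q f x) C) := by
      rw [hjd, mul_left_comm]
      exact mul_pos_iff_of_pos_left hpos
    unfold normalOrientationAux
    rw [← hO]
    by_cases hc : 0 < tsign (oM x) * juxtDet hk (ediff n q f x) C
    · rw [if_pos hc, if_pos (hiff.2 hc)]
    · rw [if_neg hc, if_neg (fun h' => hc (hiff.1 h'))]

include hf in
/-- `df_x` read in the chart at `x₀`: `ediff f x = D(f ∘ φ⁻¹)(φ x) ∘ tangentCoordChange x x₀ x`.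
[folklore] -/
theorem ediff_eq_chartDeriv_comp_tangentCoordChange {x₀ x : M} (hx : x ∈ (chartAt (𝔼 n) x₀).source) :
    ediff n q f x = (chartDeriv (𝓡 n) f x₀ (extChartAt (𝓡 n) x₀ x)).comp
      (tangentCoordChange (𝓡 n) x x₀ x) := by
  have hx' : x ∈ (extChartAt (𝓡 n) x₀).source := by rwa [extChartAt_source]
  have hfd : MDifferentiableAt (𝓡 n) (𝓡 q) f x := (hf x).mdifferentiableAt (by simp)
  have hA := mfderiv_eq_chartDeriv_comp (I := 𝓡 n) hx' hfd
  have hfun : ⇑(extChartAt (𝓡 n) x₀) = ⇑(chartAt (𝔼 n) x₀) := by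
    rw [extChartAt_coe, modelWithCornersSelf_coe, Function.id_comp]
  have hT : mfderiv (𝓡 n) 𝓘(ℝ, 𝔼 n) (extChartAt (𝓡 n) x₀) x = tangentCoordChange (𝓡 n) x x₀ x := by
    rw [hfun]
    exact mfderiv_chartAt_eq_tangentCoordChange (I := 𝓡 n) hx
  unfold ediff
  rw [hA, hT]
  rfl

/-- **The normal orientation rule defines an orientation of the normal bundle.**
[cite: MilnorStasheff1974, §9 p. 96, §11] -/
theorem isOrientation_normalOrientation :
    (ProjBundle.normal hk f hf himm).IsOrientation (normalOrientation hk hf himm oM) := by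
  refine ⟨fun x₀ => ?_⟩
  -- the frames of the bundle chart at `x₀`, the chart derivative and the coordinate change
  obtain ⟨A, hA⟩ : ∃ A : M → (𝔼 k →L[ℝ] 𝔼 q), A = (ProjBundle.normal hk f hf himm).frameAt x₀ :=
    ⟨_, rfl⟩
  obtain ⟨Tc, hTc⟩ : ∃ Tc : M → (𝔼 n →L[ℝ] 𝔼 q),
      ∀ x, Tc x = chartDeriv (𝓡 n) f x₀ (extChartAt (𝓡 n) x₀ x) := ⟨_, fun _ => rfl⟩
  obtain ⟨hcc, hhcc⟩ : ∃ hcc : M → (𝔼 n →L[ℝ] 𝔼 n),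
      ∀ x, hcc x = tangentCoordChange (𝓡 n) x x₀ x := ⟨_, fun _ => rfl⟩
  obtain ⟨J, hJ⟩ : ∃ J : M → ℝ, ∀ x, J x = juxtDet hk (Tc x) (A x) := ⟨_, fun _ => rfl⟩
  have hS : (chartAt (𝔼 n) x₀).source ∈ 𝓝 x₀ :=
    (chartAt (𝔼 n) x₀).open_source.mem_nhds (mem_chart_source _ x₀)
  have hG : (ProjBundle.normal hk f hf himm).goodSet x₀ ∈ 𝓝 x₀ :=
    ((ProjBundle.normal hk f hf himm).isOpen_goodSet x₀).mem_nhds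
      ((ProjBundle.normal hk f hf himm).mem_goodSet_self x₀)
  -- (F2) the juxtaposition determinant factors through the coordinate change
  have hjd : ∀ x ∈ (chartAt (𝔼 n) x₀).source, juxtDet hk (ediff n q f x) (A x) =
      LinearMap.det (hcc x : 𝔼 n →ₗ[ℝ] 𝔼 n) * J x := by
    intro x hx
    rw [ediff_eq_chartDeriv_comp_tangentCoordChange hf hx, ← hTc, ← hhcc, ← (A x).comp_id,
      juxtDet_comp, hJ]
    simp
  -- (F4) nonvanishing
  have hne : ∀ x ∈ (chartAt (𝔼 n) x₀).source ∩ (ProjBundle.normal hk f hf himm).goodSet x₀,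
      LinearMap.det (hcc x : 𝔼 n →ₗ[ℝ] 𝔼 n) ≠ 0 ∧ J x ≠ 0 := by
    intro x hx
    have h := juxtDet_ediff_ne_zero hk hf himm x (A x) (by rw [hA]; exact hx.2.2)
      (by rw [hA]; exact (ProjBundle.normal hk f hf himm).range_frameAt_of_mem hx.2)
    rw [hjd x hx.1] at h
    exact ⟨left_ne_zero_of_mul h, right_ne_zero_of_mul h⟩
  -- (F3) continuity of `J` on the chart source
  have hJc : ContinuousOn J (chartAt (𝔼 n) x₀).source := by
    have hsrc : (chartAt (𝔼 n) x₀).source = (extChartAt (𝓡 n) x₀).source :=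
      (extChartAt_source (𝓡 n) x₀).symm
    have hT : ContinuousOn Tc (chartAt (𝔼 n) x₀).source := by
      have hfun : Tc = fun x => chartDeriv (𝓡 n) f x₀ (extChartAt (𝓡 n) x₀ x) := funext hTc
      rw [hfun, hsrc]
      exact (contDiffOn_chartDeriv (I := 𝓡 n) hf x₀).continuousOn.comp
        (continuousOn_extChartAt x₀) fun x hx => (extChartAt (𝓡 n) x₀).map_source hx
    have hAc : Continuous A := by
      rw [hA]
      exact (ProjBundle.normal hk f hf himm).continuous_frameAt x₀
    have hfunJ : J = (fun TC : (𝔼 n →L[ℝ] 𝔼 q) × (𝔼 k →L[ℝ] 𝔼 q) => juxtDet hk TC.1 TC.2) ∘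
        fun x => (Tc x, A x) := funext fun x => hJ x
    rw [hfunJ]
    exact (continuous_juxtDet hk).comp_continuousOn (hT.prodMk hAc.continuousOn)
  -- (F5) the sign of `J` is locally constant at `x₀`
  have hx₀ : x₀ ∈ (chartAt (𝔼 n) x₀).source ∩ (ProjBundle.normal hk f hf himm).goodSet x₀ :=
    ⟨mem_chart_source _ x₀, (ProjBundle.normal hk f hf himm).mem_goodSet_self x₀⟩
  have hJ0 : J x₀ ≠ 0 := (hne x₀ hx₀).2
  have hJa : ContinuousAt J x₀ := (hJc x₀ hx₀.1).continuousAt hS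
  have hJsign : ∀ᶠ x in 𝓝 x₀, 0 < J x * J x₀ := by
    rcases lt_or_gt_of_ne hJ0 with hneg | hpos
    · filter_upwards [hJa.eventually (gt_mem_nhds hneg)] with x hx
      exact mul_pos_of_neg_of_neg hx hneg
    · filter_upwards [hJa.eventually (lt_mem_nhds hpos)] with x hx
      exact mul_pos hx hpos
  -- (F6) the smooth orientation against the coordinate change
  have hoM := oM.eventually_eq_iff x₀
  -- the key equivalence with a condition independent of `x`
  have key : ∀ᶠ x in 𝓝 x₀, ∀ hx : x ∈ (ProjBundle.normal hk f hf himm).goodSet x₀,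
      (normalOrientation hk hf himm oM x = (ProjBundle.normal hk f hf himm).chartOrientation hx ↔
        0 < tsign (oM x₀) * J x₀) := by
    filter_upwards [hJsign, hoM, hS, hG] with x hJx hox hxS hxG
    intro hx
    -- frame independence: compute with the chart frame `A x`
    subst hA
    have h1 : normalOrientation hk hf himm oM x =
        normalOrientationAux hk hf himm oM x ((ProjBundle.normal hk f hf himm).frameAt x₀ x) hx.2
          ((ProjBundle.normal hk f hf himm).range_frameAt_of_mem hx) :=
      normalOrientationAux_eq hk hf himm oM x _ _ _ _ _ _
    rw [h1, ProjBundle.chartOrientation, normalOrientationAux_eq_iff, hjd x hxS]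
    -- sign bookkeeping
    obtain ⟨hdet, hJne⟩ := hne x ⟨hxS, hxG⟩
    have ht : 0 < tsign (oM x) * LinearMap.det (hcc x : 𝔼 n →ₗ[ℝ] 𝔼 n) * tsign (oM x₀) := by
      by_cases heq : oM x = oM x₀
      · have hd : 0 < LinearMap.det (hcc x : 𝔼 n →ₗ[ℝ] 𝔼 n) := by rw [hhcc]; exact hox.1 heq
        have htt : 0 < tsign (oM x) * tsign (oM x₀) := (tsign_mul_tsign_pos_iff _ _).2 heq
        nlinarith [mul_pos htt hd]
      · have hd : LinearMap.det (hcc x : 𝔼 n →ₗ[ℝ] 𝔼 n) < 0 :=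
          lt_of_le_of_ne (not_lt.1 fun h' => heq (hox.2 (by rw [← hhcc]; exact h'))) hdet
        have htt : tsign (oM x) * tsign (oM x₀) < 0 :=
          lt_of_le_of_ne (not_lt.1 fun h' => heq ((tsign_mul_tsign_pos_iff _ _).1 h'))
            (mul_ne_zero (tsign_ne_zero _) (tsign_ne_zero _))
        nlinarith [mul_pos_of_neg_of_neg htt hd]
    have hprod : 0 < (tsign (oM x) * (LinearMap.det (hcc x : 𝔼 n →ₗ[ℝ] 𝔼 n) * J x)) *
        (tsign (oM x₀) * J x₀) := by
      have : (tsign (oM x) * (LinearMap.det (hcc x : 𝔼 n →ₗ[ℝ] 𝔼 n) * J x)) *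
          (tsign (oM x₀) * J x₀) =
          (tsign (oM x) * LinearMap.det (hcc x : 𝔼 n →ₗ[ℝ] 𝔼 n) * tsign (oM x₀)) * (J x * J x₀) := by
        ring
      rw [this]
      exact mul_pos ht hJx
    exact pos_iff_pos_of_mul_pos hprod
  -- conclude: both sides are equivalent to the same condition
  have key₀ := key.self_of_nhds ((ProjBundle.normal hk f hf himm).mem_goodSet_self x₀)
  filter_upwards [key] with x hx
  intro hxg
  rw [hx hxg, key₀]

end Normal

end Literature.Topology.Immersions
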